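import Summits.QuantumFields.YangMills.Theorems.BalabanUVNodesK0Stub1Letter165OfCriticalFlatOps
import Summits.QuantumFields.YangMills.Theorems.UnitScaleTiltProp8HalvingELJunction
import HarnessLib

/-!
# K0⁷ STUB 1 (`stub_prop8StepCoP13`), sub-target S4a — **THE Δ_a-ROW OF (158): THE SECOND-ORDER LETTER `∂^{η*}∂^ηA₁` OF THE TANGENT COMPONENT AT NODE 00's
# CARRIER** — on the residual-Landau slice (153) the solution `A₁ = −G̃_V w` of [15] (158) has `∂*∂A₁ = Δ_aA₁ = −w + Q*(QGQ*)⁻¹QG·w` EXACTLY (print p. 298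
# (131)–(133)); read through every real reading `Re φ`, `φ ∈ M_N(ℂ)*`, this IS the third real row `dcsE ξ⁻¹ (dcE ξ⁻¹ (Re φ ∘ A₁))` of the S6 head
# (`N07Letters10OfRealRows.letters10On_of_realRows`), hence the `‖∂^{ξ*}∂^ξA₁‖` letter of `Sect2.LocalGauge10On` — with NO Green's-function row, NO Hodge identity, NO
# [B9] (3.49); the one estimate it costs is the MULTIPLIER LETTER of `𝔐 := Q*(QGQ*)⁻¹QG` (displayed)

Cell `pub-ymgap`, width seat `pub-ymgap-k0-s1-w1` g4 (INTENT-1).  `--kind proof --supports stmt-QuantumFields-20541 --as helper`; count-neutral; def-free.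
[15] = [Balaban1985Variational]; [B6] = [Balaban1984PropagatorsII]; [6] = [Balaban1985RegularSpaces].

WHY.  Print p. 304 (165): *«|A|, |∇^ηA|, |∂^{η*}∂^ηA|, |Δ^ηA| < …»* for `A = A₁ + HB − HD(A₁ + HB)` (159); the S6 token at NODE 00 (`LocalLetters165TopStepCore` via
`localGauge10On_of_eq159`) reads the clause `Sect2.LocalGauge10On Y ξ t U` (`Node00/LocalGaugeCoDivergenceLetters`), i.e. EXACTLY the three letters `‖A‖, ‖∇^ξA‖,
‖∂^{ξ*}∂^ξA‖` (*«NO Laplacian member»*), and the third letter through a real reading `φ` is lit-balaban's `dcsE ξ⁻¹ (dcE ξ⁻¹ (φ ∘ A))`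
(`N07Letters10OfRealRows.apply_codiffCurlA_eq_dcsE_dcE`).  This seat's p604735 supplies the sup and gradient rows of `A₁`; THIS FILE supplies the third.  Print's
second-order information on `A₁` is NOT a letter of `G̃` (p. 296: *«the regularity properties of the operator G̃ … do not give us these second order bounds»*;
UST VET ITEM 12: the `∂*∂G̃` sup row is FALSE) — it is THE Δ_a-ROW OF THE EQUATION ITSELF: p. 297 *«The configuration A′₁ satisfies RD*A′₁ = 0, hence the above
equation can be written … where Δ_a = Δ + DRD* + Q*aQ»*, p. 298 *«P₀ = I − GQ*(QGQ*)⁻¹Q. (131) … QA₀ = 0, hence P₀A₀ = A₀, Δ_aA₀ = (Δ + DRD*)A₀ … A₀ = −GP₀*J −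
… (133)»*.  Here print's `Δ` is the FLAT ACTION HESSIAN `Δ(1) = ∂*∂` — lit-balaban [B6] (2.19) `deltaAE D c w = ∂*∂ + ∂R∂* + Q*aQ` (`B6SectAVectorModelV1` :56), the
operator of this lane's (128)∕(158) currency (p585110 → p595460 `eq143_flatOps_matrixFields` → p596821∕p604735, hypothesis `h128` over the extension `Δ_V` of THAT
`deltaAE`) — so on the slice `R∂*A₁ = 0` (with `QA₁ = 0`, automatic): `∂*∂A₁ = Δ_aA₁ = −w + Q*(QGQ*)⁻¹QGw`.  Cell ym3-torus closed the (165)-`A₁` `∂^{η*}∂^η` clause of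
its halving package exactly this way (`UnitScaleTiltProp8HalvingA1Row165`, `…HalvingELJunction`, d = 3, `M_2(ℂ)`, pull-back letters); its §1 is MODEL-GENERIC and is
CONSUMED BY NAME here (`HalvingELJunction.dcsE_dcE_eq_of_slice_of_eq_neg_Gt`, `RE_dsE_sub_hOp`, `RE_dsE_add_hOp` over `FlatCubeOperators.deltaAE_Gt ∕ RE_dsE_hOp` =
lit-balaban (2.34) `B6SectACriticalPointV1.eq234_left_V1`).  THIS FILE is the NODE 00 edition (generic `P`, generic size, the TORUS letters `dcsE ∕ dcE`, no pull-back).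

WHAT IS PROVED (sorry-free; no definition; axioms standard).
* §1 `re_reading_kernel` — a reading `Re φ` (`φ : M_n(ℂ) →L[ℂ] ℂ`) of a kernel sum `Σ_i ((Te_i)(k) : ℂ)·B(i)` is `T` of the read datum (UST `HalvingELJunction.linear_kernel`,
  generic size, p595460's `((r : ℝ) : ℂ)•` kernels); `toLp_re_reading_extension` (`toLp (Re φ ∘ T_VA) = T (toLp (Re φ ∘ A))` for operators between Euclidean spaces);
  `duality_reading_eq_re` (the head's duality readings `y ↦ r·Re(u·f(y))` ARE `Re φ`-readings, `φ = (r·u)•f`).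
* §2 (model level: every `P`, nested family `D`, `c ≠ 0`, `w > 0`, matrix size) ★★ `dcsE_dcE_re_reading_of_solution` — THE Δ_a-ROW: for the kernel extensions `G̃_V` of
  `G − HQG` and `𝔐_V` of `Q*(QGQ*)⁻¹QG`, every solution `A₁ + G̃_Vw = 0` of (158) and reading with `R∂*(Re φ ∘ A₁) = 0`: `∂*∂(Re φ ∘ A₁) = −(Re φ ∘ w) + Re φ ∘ (𝔐_Vw)` in
  `ℓ²(bonds)`; `RE_dsE_re_reading_sub_HV ∕ _add_HV` — THE SLICE IS BLIND TO `H_V`-IMAGES ((153) passes through `A = A′ − H_V𝔇(A′)` (157) and `A₁ = A′ − H_V(Q_VA′)` (159)).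
* §2b `eq158_flatOps_matrixFields_inst` — p595460's (128) ⟹ (158) with BOTH `DecidableEq` instances of the unit fields as arguments (its §2 re-run over its generic §1).
* §3 ★★ `curlCurl_row_of_critical128_model` (model level, skew tests) and §4 ★★★ `curlCurl_row_of_critical128` (NODE 00's fine torus `Site (F.P K) 0`, `c = Lᵏ`, `a ≡ 1`,
  `M_N(ℂ)`, p604735's hypothesis block: `𝔰𝔲(N)`-valued (128), Prop. 4's weighted (98)-slot `hWq`, sizes `≤ ρ < a₃`) + the slice for every reading of `X` + the
  DISPLAYED multiplier letter `hM` on a bond set `S` with `wt₃ = 1` ⇒ for every duality reading and `b ∈ S`: `|dcsE Lᵏ (dcE Lᵏ (b′ ↦ r·Re(u·f(A₁ b′)))) b| ≤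
  (1 + B_𝔐)·(C₄·ρ²)`, `A₁ = X − H_V(Q_VX)` — LITERALLY the third conjunct of `letters10On_of_realRows`' `hrows` at `ξ⁻¹ = Lᵏ` (the first two are p604735's).
HONEST SCOPE.  Exact finite-dimensional algebra over kernel-checked lit-balaban ∕ UST identities plus one triangle inequality; NO estimate is proved: the multiplier
letter `hM` (print: rows of `H₀`, (130), (137)–(140) pp. 298–299; UST: `HalvingELJunction.QsE_EE_eq` ⊕ the text's `∂*∂`-row of `H` ⊕ a `G` band row ⊕ the `Q`
contraction letter, `HalvingMultiplierLetter`), Prop. 4's slot `hWq` (S4b), (128) (S2), the slice (153) (n07-w3's `TorusCoverLandau153RE.RE_dsE_re_eq_zero_of_cubeDomains`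
shape, consumed verbatim) and the sizes (S3) stay DISPLAYED.  FLAT background; nothing of Bałaban's analysis asserted; `stub_prop8StepCoP13` ∕ K0⁷ NOT closed; N07
NOT discharged; counts unmoved (28∕28 · 5∕27); one finite 𝕋⁴ programme at fixed ε — R4 closes the conditional finite-𝕋⁴ rung `BalabanLadder.UV` only, never the
summit; the YM mass gap (Clay) is NOT proved by any of this; nothing continuum ∕ ℝ⁴ ∕ OS.  No `sorry`, no `def`, no `instance`, no `notation`.

References: [15] (128) p.297, (130)–(133) p.298, (137)–(140) pp.298–299, (153) p.301, (157)–(159) pp.302–303, (165) p.304, Thm 1 (10) p.279; [B6] (2.12) p.225,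
(2.19)–(2.22) p.226, (2.34)–(2.35) p.228; [6] (1.2) p.76, (1.140) p.100.
-/

set_option autoImplicit false
noncomputable section
open scoped BigOperators InnerProductSpace Matrix Matrix.Norms.L2Operator

namespace Summit.QuantumFields.YangMills.Theorems.K0Stub1CurlCurlRowOfEq158

open Literature.MathematicalPhysics.QuantumFieldTheory.Balaban1983to89
open Literature.MathematicalPhysics.QuantumFieldTheory.Balaban1983to89.T4Continuum (T4Family)
open Literature.MathematicalPhysics.QuantumFieldTheory.BalabanImbrieJaffe1984to88.BIJ85AxialPropagator411 (BondSpace)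
open B6SectADomainsV1 (Domains)
open B6SectAOperatorsV1 (BondIdx BondIdxSpace QE QsE RE dsE dcE dcsE)
open B6SectAVectorModelV1 (deltaAE GE EE)
open B6SectA (hOp)
open T4AdjointCovarianceUnitary (lieSU mem_lieSU_iff)
open Summit.QuantumFields.YangMills.Theorems.HalvingELJunction (dcsE_dcE_eq_of_slice_of_eq_neg_Gt RE_dsE_sub_hOp RE_dsE_add_hOp)
open Summit.QuantumFields.YangMills.Theorems.K0Stub1Eq158FlatOpsMatrixFields (eq143_matrix_of_scalar)
open Summit.QuantumFields.YangMills.Theorems.K0Stub1Eq158FlatOpsAtRecord (eq143_of_critical128_flatOps)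
open Summit.QuantumFields.YangMills.Theorems.K0Stub1Letter165OfCriticalFlatOps (pairing_skew_of_traceless pairing_traceless_of_lieSU coe_lieSU_skew coe_lieSU_trace)

variable {N : ℕ}

/-! ## §1  Readings `Re φ` of kernel sums and of lit-balaban operator extensions -/

section Readings

variable {ι κ : Type*} [Fintype ι] [DecidableEq ι] {n : Type*}

/-- **`Re φ(𝔄(k)) = T(Re φ ∘ B)(k)`** for the kernel extension `𝔄(k) = Σ_i ((Te_i)(k) : ℂ)·B(i)` of a real-linear `T` to `M_n(ℂ)`-valued data (p595460's kernel formulas) and every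
continuous `ℂ`-linear `φ` (UST `HalvingELJunction.linear_kernel` at generic size, `Re φ` edition). [cite: Balaban1985Variational, (158) p.302, p.288] -/
theorem re_reading_kernel (T : (ι → ℝ) →ₗ[ℝ] (κ → ℝ)) {B : ι → Matrix n n ℂ} {𝔄 : κ → Matrix n n ℂ}
    (h𝔄 : ∀ k, 𝔄 k = ∑ i, ((T (Pi.single i 1) k : ℝ) : ℂ) • B i) (φ : Matrix n n ℂ →L[ℂ] ℂ) (k : κ) :
    (φ (𝔄 k)).re = T (fun i => (φ (B i)).re) k := by
  have hX : (fun i => (φ (B i)).re) = ∑ i, (φ (B i)).re • (Pi.single i (1 : ℝ) : ι → ℝ) := by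
    funext i'
    rw [Finset.sum_apply, Finset.sum_eq_single i' (fun i _ hi => by simp [Ne.symm hi]) (fun h => absurd (Finset.mem_univ _) h)]
    simp
  rw [hX, map_sum, Finset.sum_apply, h𝔄 k, map_sum, Complex.re_sum]
  refine Finset.sum_congr rfl fun i _ => ?_
  rw [map_smul, smul_eq_mul, Complex.re_ofReal_mul, LinearMap.map_smul, Pi.smul_apply, smul_eq_mul, mul_comm]

/-- **THE SAME FOR A lit-balaban OPERATOR BETWEEN EUCLIDEAN SPACES**: if `T_V` is the kernel extension of `T : ℓ²(ι) → ℓ²(κ)` (`T_VA(k) = Σ_i ((Te_i)(k) : ℂ)·A(i)`), then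
`toLp (Re φ ∘ T_VA) = T (toLp (Re φ ∘ A))`. [cite: Balaban1985Variational, (158) p.302, p.288] -/
theorem toLp_re_reading_extension (T : EuclideanSpace ℝ ι →ₗ[ℝ] EuclideanSpace ℝ κ) {A : ι → Matrix n n ℂ} {𝔄 : κ → Matrix n n ℂ}
    (hTV : ∀ k, 𝔄 k = ∑ i, ((WithLp.ofLp (T (WithLp.toLp 2 (Pi.single i 1))) k : ℝ) : ℂ) • A i)
    (φ : Matrix n n ℂ →L[ℂ] ℂ) :
    WithLp.toLp 2 (fun k => (φ (𝔄 k)).re) = T (WithLp.toLp 2 (fun i => (φ (A i)).re)) := by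
  set Tfn : (ι → ℝ) →ₗ[ℝ] (κ → ℝ) :=
    (WithLp.linearEquiv 2 ℝ (κ → ℝ)).toLinearMap ∘ₗ T ∘ₗ (WithLp.linearEquiv 2 ℝ (ι → ℝ)).symm.toLinearMap with hTfn_def
  have hTfn : ∀ (f : ι → ℝ) (k : κ), Tfn f k = WithLp.ofLp (T (WithLp.toLp 2 f)) k := fun f k => by
    simp only [hTfn_def, LinearMap.comp_apply, LinearEquiv.coe_coe, WithLp.coe_linearEquiv, WithLp.coe_symm_linearEquiv]
  have h𝔄 : ∀ k, 𝔄 k = ∑ i, ((Tfn (Pi.single i 1) k : ℝ) : ℂ) • A i := fun k => by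
    rw [hTV k]
    exact Finset.sum_congr rfl fun i _ => by rw [hTfn]
  ext k
  rw [PiLp.toLp_apply, re_reading_kernel Tfn h𝔄 φ k, hTfn]

/-- The S6 head's duality readings `y ↦ r·Re(u·f(y))` (`N07Letters10OfRealRows.letters10On_of_realRows`) ARE `Re φ`-readings with `φ = (r·u)•f`. [folklore] -/
theorem duality_reading_eq_re (f : Matrix n n ℂ →L[ℂ] ℂ) (u : ℂ) (r : ℝ) (y : Matrix n n ℂ) :
    r * (u * f y).re = (((((r : ℝ) : ℂ) * u) • f) y).re := by
  rw [show ((((r : ℝ) : ℂ) * u) • f) y = (((r : ℝ) : ℂ) * u) • f y from rfl, smul_eq_mul, mul_assoc, Complex.re_ofReal_mul]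
end Readings

/-! ## §2  The Δ_a-row of (158) on the slice, model level (every `P`, every nested family, every matrix size) -/

section Model

variable {P : Params} (D : Domains P) {c : ℝ} (hc : c ≠ 0) {w : BondIdx D → ℝ} (hw : ∀ i, 0 < w i)
variable {n : Type*}

/-- ★★ **THE Δ_a-ROW OF (158), READ THROUGH `Re φ`**: let `G̃_V`, `𝔐_V` be the kernel extensions (p595460's formulas) of print's `G̃ = G − HQG` and of the MULTIPLIER
OPERATOR `𝔐 = Q*(QGQ*)⁻¹QG` (`= (HQ)ᵀ`, print's `1 − P₀ᵀ` of (131)) for lit-balaban's `G = Δ_a⁻¹`, `H = GQ*(QGQ*)⁻¹` of a nested family `D` (lattice factor `c`, weights `a`).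
If `A₁ + G̃_Vw = 0` ((158): `w = ((δ∕δA′)V)(A₁ + HB)`) and the reading `Re φ ∘ A₁` lies on the residual-Landau slice `R∂*(Re φ ∘ A₁) = 0` ((153)), then
`∂*∂(Re φ ∘ A₁) = −(Re φ ∘ w) + Re φ ∘ (𝔐_Vw)` in `ℓ²(bonds)` — *«P₀A₀ = A₀, Δ_aA₀ = (Δ + DRD*)A₀»* with `RD*A₀ = 0` and `Δ = ∂*∂` the flat action Hessian of [B6] (2.19),
`Δ_aG̃ = 1 − Q*(QGQ*)⁻¹QG`.  UST `HalvingELJunction.dcsE_dcE_eq_of_slice_of_eq_neg_Gt` on the read field.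
[cite: Balaban1985Variational, (128) p.297, (131)–(133) p.298, (153) p.301, (158) p.302, (165) p.304; Balaban1984PropagatorsII, (2.19) p.226, (2.35) p.228] -/
theorem dcsE_dcE_re_reading_of_solution [DecidableEq (PBond P 0)]
    {GV MV : (PBond P 0 → Matrix n n ℂ) →ₗ[ℂ] (PBond P 0 → Matrix n n ℂ)}
    (hGV : ∀ (A : PBond P 0 → Matrix n n ℂ) (b : PBond P 0),
      GV A b = ∑ j, ((WithLp.ofLp ((GE D hc hw - hOp (GE D hc hw) (QsE D) (EE D hc hw) ∘ₗ QE D ∘ₗ GE D hc hw)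
        (WithLp.toLp 2 (Pi.single j 1))) b : ℝ) : ℂ) • A j)
    (hMV : ∀ (A : PBond P 0 → Matrix n n ℂ) (b : PBond P 0),
      MV A b = ∑ j, ((WithLp.ofLp ((QsE D ∘ₗ EE D hc hw ∘ₗ QE D ∘ₗ GE D hc hw) (WithLp.toLp 2 (Pi.single j 1))) b : ℝ) : ℂ) • A j)
    {A₁ v : PBond P 0 → Matrix n n ℂ} (hsol : A₁ + GV v = 0) (φ : Matrix n n ℂ →L[ℂ] ℂ)
    (hslice : RE D c (dsE c (WithLp.toLp 2 (fun b => (φ (A₁ b)).re))) = 0) :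
    dcsE c (dcE c (WithLp.toLp 2 (fun b => (φ (A₁ b)).re))) =
      -(WithLp.toLp 2 (fun b => (φ (v b)).re)) + WithLp.toLp 2 (fun b => (φ (MV v b)).re) := by
  have hA₁ : ∀ b, A₁ b = -(GV v b) := fun b => by
    have h := congrFun hsol b
    rw [Pi.add_apply, Pi.zero_apply] at h
    exact eq_neg_of_add_eq_zero_left h
  -- the read field solves `x = −G̃(Re φ ∘ v)`
  have hx : WithLp.toLp 2 (fun b => (φ (A₁ b)).re) =
      -((GE D hc hw - hOp (GE D hc hw) (QsE D) (EE D hc hw) ∘ₗ QE D ∘ₗ GE D hc hw) (WithLp.toLp 2 (fun b => (φ (v b)).re))) := by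
    rw [← toLp_re_reading_extension _ (fun b => hGV v b) φ]
    ext b
    rw [PiLp.toLp_apply, PiLp.neg_apply, PiLp.toLp_apply, hA₁ b, map_neg, Complex.neg_re]
  rw [dcsE_dcE_eq_of_slice_of_eq_neg_Gt D hc hw _ hslice hx, toLp_re_reading_extension _ (fun b => hMV v b) φ, LinearMap.comp_apply,
    LinearMap.comp_apply, LinearMap.comp_apply]

/-- **THE SLICE IS BLIND TO `H_V`-IMAGES, I**: `R∂*(Re φ ∘ (A − H_VB)) = R∂*(Re φ ∘ A)` (`R∂*H = 0`, [B6] (2.34); print p. 299 *«we have used the equality RD*H = 0»*) —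
(153) passes from `A′` to `A₁ = A′ − H_V(Q_VA′)` (159). [cite: Balaban1985Variational, p.299, (153) p.301, (159) p.303; Balaban1984PropagatorsII, (2.34)–(2.35) p.228] -/
theorem RE_dsE_re_reading_sub_HV [DecidableEq (BondIdx D)]
    {HV : (BondIdx D → Matrix n n ℂ) →ₗ[ℂ] (PBond P 0 → Matrix n n ℂ)}
    (hHV : ∀ (B : BondIdx D → Matrix n n ℂ) (b : PBond P 0),
      HV B b = ∑ t, ((WithLp.ofLp (hOp (GE D hc hw) (QsE D) (EE D hc hw) (WithLp.toLp 2 (Pi.single t 1))) b : ℝ) : ℂ) • B t)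
    (φ : Matrix n n ℂ →L[ℂ] ℂ) (A : PBond P 0 → Matrix n n ℂ) (B : BondIdx D → Matrix n n ℂ) :
    RE D c (dsE c (WithLp.toLp 2 (fun b => (φ ((A - HV B) b)).re))) = RE D c (dsE c (WithLp.toLp 2 (fun b => (φ (A b)).re))) := by
  have hsplit : WithLp.toLp 2 (fun b => (φ ((A - HV B) b)).re) =
      WithLp.toLp 2 (fun b => (φ (A b)).re) - hOp (GE D hc hw) (QsE D) (EE D hc hw) (WithLp.toLp 2 (fun t => (φ (B t)).re)) := by
    rw [← toLp_re_reading_extension _ (fun b => hHV B b) φ]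
    ext b
    rw [PiLp.sub_apply, PiLp.toLp_apply, PiLp.toLp_apply, PiLp.toLp_apply, Pi.sub_apply, map_sub, Complex.sub_re]
  rw [hsplit, RE_dsE_sub_hOp]

/-- **THE SLICE IS BLIND TO `H_V`-IMAGES, II**: `R∂*(Re φ ∘ (A + H_VB)) = R∂*(Re φ ∘ A)` — (153) passes from the gauge-fixed potential `A = A′ − H_V𝔇(A′)` (157) to
`A′ = A + H_V𝔇(A′)`. [cite: Balaban1985Variational, p.299, (153) p.301, (157) p.302; Balaban1984PropagatorsII, (2.34)–(2.35) p.228] -/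
theorem RE_dsE_re_reading_add_HV [DecidableEq (BondIdx D)]
    {HV : (BondIdx D → Matrix n n ℂ) →ₗ[ℂ] (PBond P 0 → Matrix n n ℂ)}
    (hHV : ∀ (B : BondIdx D → Matrix n n ℂ) (b : PBond P 0),
      HV B b = ∑ t, ((WithLp.ofLp (hOp (GE D hc hw) (QsE D) (EE D hc hw) (WithLp.toLp 2 (Pi.single t 1))) b : ℝ) : ℂ) • B t)
    (φ : Matrix n n ℂ →L[ℂ] ℂ) (A : PBond P 0 → Matrix n n ℂ) (B : BondIdx D → Matrix n n ℂ) :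
    RE D c (dsE c (WithLp.toLp 2 (fun b => (φ ((A + HV B) b)).re))) = RE D c (dsE c (WithLp.toLp 2 (fun b => (φ (A b)).re))) := by
  have hsplit : WithLp.toLp 2 (fun b => (φ ((A + HV B) b)).re) =
      WithLp.toLp 2 (fun b => (φ (A b)).re) + hOp (GE D hc hw) (QsE D) (EE D hc hw) (WithLp.toLp 2 (fun t => (φ (B t)).re)) := by
    rw [← toLp_re_reading_extension _ (fun b => hHV B b) φ]
    ext b
    rw [PiLp.add_apply, PiLp.toLp_apply, PiLp.toLp_apply, PiLp.toLp_apply, Pi.add_apply, map_add, Complex.add_re]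
  rw [hsplit, RE_dsE_add_hOp]
end Model

/-! ## §2b  (128) ⟹ (158) with print's flat operators, `DecidableEq` instances GENERIC (p595460 §2 re-run over its instance-generic §1) -/

section Eq158Inst

variable {P : Params} (D : Domains P) {c : ℝ} (hc : c ≠ 0) {w : BondIdx D → ℝ} (hw : ∀ i, 0 < w i)
variable {n : Type*} [Fintype n] [DecidableEq n]

/-- **p595460's `eq158_flatOps_matrixFields` WITH THE `DecidableEq` INSTANCES OF THE UNIT FIELDS AS ARGUMENTS** (p595460 §2 elaborated `Pi.single` classically; files
importing the NODE 00 chain ∕ the d = 4 port ∕ UST see `B6Prop26ReachTransplant.instDecidableEqPBond` — TECH NOTE of this seat's g3): (128) against skew tests in `ker Q_V`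
⇒ *«A₁ + G̃((δ∕δA′)V)(A₁ + HB) = 0 (158)»* for `A₁ = A′ − H_V(Q_VA′)`.  Proof = p595460's (instance-generic §1 `eq143_matrix_of_scalar` ∘ file 5 `eq143_of_critical128_flatOps`).
[cite: Balaban1985Variational, (127)–(133) pp.297–298, (143) p.300, (158) p.302; Balaban1984PropagatorsII, (2.19)–(2.22) p.226] -/
theorem eq158_flatOps_matrixFields_inst {instDE : DecidableEq (PBond P 0)} {instDB : DecidableEq (BondIdx D)}
    {DV GV : (PBond P 0 → Matrix n n ℂ) →ₗ[ℂ] (PBond P 0 → Matrix n n ℂ)} {QV : (PBond P 0 → Matrix n n ℂ) →ₗ[ℂ] (BondIdx D → Matrix n n ℂ)}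
    {HV : (BondIdx D → Matrix n n ℂ) →ₗ[ℂ] (PBond P 0 → Matrix n n ℂ)}
    (hDV : ∀ (A : PBond P 0 → Matrix n n ℂ) (b : PBond P 0),
      DV A b = ∑ j, ((WithLp.ofLp (deltaAE D c w (WithLp.toLp 2 (Pi.single j 1))) b : ℝ) : ℂ) • A j)
    (hGV : ∀ (A : PBond P 0 → Matrix n n ℂ) (b : PBond P 0),
      GV A b = ∑ j, ((WithLp.ofLp ((GE D hc hw - hOp (GE D hc hw) (QsE D) (EE D hc hw) ∘ₗ QE D ∘ₗ GE D hc hw)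
        (WithLp.toLp 2 (Pi.single j 1))) b : ℝ) : ℂ) • A j)
    (hQV : ∀ (A : PBond P 0 → Matrix n n ℂ) (t : BondIdx D),
      QV A t = ∑ j, ((WithLp.ofLp (QE D (WithLp.toLp 2 (Pi.single j 1))) t : ℝ) : ℂ) • A j)
    (hHV : ∀ (B : BondIdx D → Matrix n n ℂ) (b : PBond P 0),
      HV B b = ∑ t, ((WithLp.ofLp (hOp (GE D hc hw) (QsE D) (EE D hc hw) (WithLp.toLp 2 (Pi.single t 1))) b : ℝ) : ℂ) • B t)
    (W : (PBond P 0 → Matrix n n ℂ) → (PBond P 0 → Matrix n n ℂ)) {A' : PBond P 0 → Matrix n n ℂ} (hA : ∀ j, (A' j)ᴴ = -A' j)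
    (hW : ∀ j, (W A' j)ᴴ = -(W A' j))
    (h128 : ∀ δ : PBond P 0 → Matrix n n ℂ, (∀ j, (δ j)ᴴ = -δ j) → QV δ = 0 → ∑ j, ((δ j)ᴴ * (DV A' j + W A' j)).trace.re = 0) :
    (A' - HV (QV A')) + GV (W ((A' - HV (QV A')) + HV (QV A'))) = 0 := by
  have h143 : A' - HV (QV A') = -(GV (W A')) := by
    refine eq143_matrix_of_scalar
      ((WithLp.linearEquiv 2 ℝ (PBond P 0 → ℝ)).toLinearMap ∘ₗ deltaAE D c w ∘ₗ (WithLp.linearEquiv 2 ℝ (PBond P 0 → ℝ)).symm.toLinearMap)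
      ((WithLp.linearEquiv 2 ℝ (PBond P 0 → ℝ)).toLinearMap ∘ₗ (GE D hc hw - hOp (GE D hc hw) (QsE D) (EE D hc hw) ∘ₗ QE D ∘ₗ GE D hc hw) ∘ₗ
        (WithLp.linearEquiv 2 ℝ (PBond P 0 → ℝ)).symm.toLinearMap)
      ((WithLp.linearEquiv 2 ℝ (BondIdx D → ℝ)).toLinearMap ∘ₗ QE D ∘ₗ (WithLp.linearEquiv 2 ℝ (PBond P 0 → ℝ)).symm.toLinearMap)
      ((WithLp.linearEquiv 2 ℝ (PBond P 0 → ℝ)).toLinearMap ∘ₗ hOp (GE D hc hw) (QsE D) (EE D hc hw) ∘ₗ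
        (WithLp.linearEquiv 2 ℝ (BondIdx D → ℝ)).symm.toLinearMap)
      (fun A b => ?_) (fun A b => ?_) (fun A t => ?_) (fun B b => ?_) (fun x u hx => ?_) hA hW h128
    · simp only [LinearMap.comp_apply, LinearEquiv.coe_coe, WithLp.coe_linearEquiv, WithLp.coe_symm_linearEquiv]; exact hDV A b
    · simp only [LinearMap.comp_apply, LinearEquiv.coe_coe, WithLp.coe_linearEquiv, WithLp.coe_symm_linearEquiv]; exact hGV A b
    · simp only [LinearMap.comp_apply, LinearEquiv.coe_coe, WithLp.coe_linearEquiv, WithLp.coe_symm_linearEquiv]; exact hQV A t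
    · simp only [LinearMap.comp_apply, LinearEquiv.coe_coe, WithLp.coe_linearEquiv, WithLp.coe_symm_linearEquiv]; exact hHV B b
    -- file 5's scalar theorem, transported along `ofLp ∕ toLp` (p595460's lines)
    simp only [LinearMap.comp_apply, LinearEquiv.coe_coe, WithLp.coe_linearEquiv, WithLp.coe_symm_linearEquiv, WithLp.toLp_ofLp] at hx ⊢
    have h5 := eq143_of_critical128_flatOps D hc hw (A' := WithLp.toLp 2 x) (v := WithLp.toLp 2 u) ?_
    · have h6 := congrArg WithLp.ofLp h5
      rw [WithLp.ofLp_sub, WithLp.ofLp_toLp, WithLp.ofLp_neg] at h6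
      exact h6
    · intro δ hδ
      have hy := hx (WithLp.ofLp δ) (by rw [WithLp.toLp_ofLp, LinearMap.mem_ker.mp hδ, WithLp.ofLp_zero])
      rw [WithLp.toLp_ofLp] at hy
      rw [EuclideanSpace.inner_eq_star_dotProduct, star_trivial, dotProduct, ← hy]
      refine Finset.sum_congr rfl fun j _ => ?_
      rw [mul_comm, WithLp.ofLp_add, Pi.add_apply, WithLp.ofLp_toLp]
  rw [sub_add_cancel, h143, neg_add_cancel]
end Eq158Inst

/-! ## §3  The third real row of the head for `A₁ = A′ − H_V(Q_VA′)`, model level (every `P`, `D`, `c`, `a`, matrix size) -/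

section Row

variable {P : Params} (D : Domains P) {c : ℝ} (hc : c ≠ 0) {w : BondIdx D → ℝ} (hw : ∀ i, 0 < w i)
variable {n : Type*} [Fintype n] [DecidableEq n]

/-- ★★ **(128)-CRITICAL + (152)-SMALL + (153)-SLICE ⇒ THE `∂*∂` ROW FOR `A₁ = A′ − H_V(Q_VA′)`, MODULO THE MULTIPLIER LETTER — MODEL LEVEL** (every `P`, `D`, `c`,
`a`, matrix size; skew-Hermitian `A′` and tests): p595460's kernel-formula extensions `Δ_V, G̃_V, Q_V, H_V` and the extension `𝔐_V` of `𝔐 = Q*(QGQ*)⁻¹QG`, Prop. 4's weighted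
(98)-slot `hWq` (gradient factor `ℓ`), (128) against skew tests in `ker Q_V`, sizes `≤ ρ < a₃`, the slice for every reading `Re φ ∘ A′`, weights `wt₃ = 1` on `S`, and the
DISPLAYED letter `hM` (`|𝔐g(b)| ≤ B_𝔐·β` on `S` whenever `wt₃|g| ≤ β`) ⇒ `|dcsE c (dcE c (b′ ↦ r·Re(u·f(A₁ b′)))) b| ≤ (1 + B_𝔐)·(C₄·ρ²)` on `S` for every duality
reading of norm `≤ 1`: (158) by §2b, the slice for `A₁` and the Δ_a-row by §2, `|Re φ(w b)| ≤ ‖w b‖ ≤ C₄ρ²` and `|Re φ((𝔐_Vw) b)| = |𝔐(Re φ ∘ w)(b)| ≤ B_𝔐·C₄ρ²`.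
[cite: Balaban1985Variational, (128) p.297, (131)–(133) p.298, (152)–(153) p.301, (158) p.302, (165) p.304; Balaban1984PropagatorsII, (2.19) p.226, (2.35) p.228] -/
theorem curlCurl_row_of_critical128_model {instDE : DecidableEq (PBond P 0)} {instDB : DecidableEq (BondIdx D)}
    (wt : ℕ → PBond P 0 → ℝ) (hw0 : ∀ m b, 0 ≤ wt m b)
    {DV GV MV : (PBond P 0 → Matrix n n ℂ) →ₗ[ℂ] (PBond P 0 → Matrix n n ℂ)} {QV : (PBond P 0 → Matrix n n ℂ) →ₗ[ℂ] (BondIdx D → Matrix n n ℂ)}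
    {HV : (BondIdx D → Matrix n n ℂ) →ₗ[ℂ] (PBond P 0 → Matrix n n ℂ)}
    (hDV : ∀ (A : PBond P 0 → Matrix n n ℂ) (b : PBond P 0),
      DV A b = ∑ j, ((WithLp.ofLp (deltaAE D c w (WithLp.toLp 2 (Pi.single j 1))) b : ℝ) : ℂ) • A j)
    (hGV : ∀ (A : PBond P 0 → Matrix n n ℂ) (b : PBond P 0),
      GV A b = ∑ j, ((WithLp.ofLp ((GE D hc hw - hOp (GE D hc hw) (QsE D) (EE D hc hw) ∘ₗ QE D ∘ₗ GE D hc hw)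
        (WithLp.toLp 2 (Pi.single j 1))) b : ℝ) : ℂ) • A j)
    (hQV : ∀ (A : PBond P 0 → Matrix n n ℂ) (t : BondIdx D),
      QV A t = ∑ j, ((WithLp.ofLp (QE D (WithLp.toLp 2 (Pi.single j 1))) t : ℝ) : ℂ) • A j)
    (hHV : ∀ (B : BondIdx D → Matrix n n ℂ) (b : PBond P 0),
      HV B b = ∑ t, ((WithLp.ofLp (hOp (GE D hc hw) (QsE D) (EE D hc hw) (WithLp.toLp 2 (Pi.single t 1))) b : ℝ) : ℂ) • B t)
    (hMV : ∀ (A : PBond P 0 → Matrix n n ℂ) (b : PBond P 0),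
      MV A b = ∑ j, ((WithLp.ofLp ((QsE D ∘ₗ EE D hc hw ∘ₗ QE D ∘ₗ GE D hc hw) (WithLp.toLp 2 (Pi.single j 1))) b : ℝ) : ℂ) • A j)
    (W : (PBond P 0 → Matrix n n ℂ) → (PBond P 0 → Matrix n n ℂ)) {C₄ a₃ ρ ℓ : ℝ}
    (hWq : ∀ (Y : PBond P 0 → Matrix n n ℂ) (r : ℝ), r < a₃ → (∀ b, wt 1 b * ‖Y b‖ ≤ r) →
      (∀ (b : PBond P 0) (ν : Fin P.d), wt 2 b * ℓ * ‖Y ⟨b.src.shift ν, b.dir⟩ - Y b‖ ≤ r) →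
        ∀ b, wt 3 b * ‖W Y b‖ ≤ C₄ * r ^ 2)
    {A' : PBond P 0 → Matrix n n ℂ} (hA : ∀ j, (A' j)ᴴ = -A' j) (hWA : ∀ j, (W A' j)ᴴ = -(W A' j))
    (h128 : ∀ δ : PBond P 0 → Matrix n n ℂ, (∀ j, (δ j)ᴴ = -δ j) → QV δ = 0 →
      ∑ j, ((δ j)ᴴ * (DV A' j + W A' j)).trace.re = 0)
    (hρ : ρ < a₃) (h1 : ∀ b, wt 1 b * ‖A' b‖ ≤ ρ)
    (h2 : ∀ (b : PBond P 0) (ν : Fin P.d), wt 2 b * ℓ * ‖A' ⟨b.src.shift ν, b.dir⟩ - A' b‖ ≤ ρ)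
    (hslice : ∀ φ : Matrix n n ℂ →L[ℂ] ℂ, RE D c (dsE c (WithLp.toLp 2 (fun b => (φ (A' b)).re))) = 0)
    {S : Set (PBond P 0)} (hS : ∀ b ∈ S, wt 3 b = 1) {BM : ℝ}
    (hM : ∀ (g : PBond P 0 → ℝ) (β : ℝ), 0 ≤ β → (∀ b, wt 3 b * |g b| ≤ β) → ∀ b ∈ S,
      |(QsE D (EE D hc hw (QE D (GE D hc hw (WithLp.toLp 2 g))))) b| ≤ BM * β) :
    ∀ (f : Matrix n n ℂ →L[ℂ] ℂ) (u : ℂ) (r : ℝ), (∀ y : Matrix n n ℂ, |r * (u * f y).re| ≤ ‖y‖) →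
      ∀ b ∈ S, |dcsE c (dcE c (WithLp.toLp 2 fun b' => r * (u * f ((A' - HV (QV A')) b')).re)) b| ≤ (1 + BM) * (C₄ * ρ ^ 2) := by
  intro f u r hf b hb
  have hsol : (A' - HV (QV A')) + GV (W A') = 0 := by
    have h := eq158_flatOps_matrixFields_inst D hc hw hDV hGV hQV hHV W hA hWA h128
    rwa [sub_add_cancel] at h
  -- the reading `φ = (r·u)•f`, of norm `≤ 1`
  have hφ : ∀ y, r * (u * f y).re = (((((r : ℝ) : ℂ) * u) • f) y).re := fun y => duality_reading_eq_re f u r y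
  have hφle : ∀ y, |(((((r : ℝ) : ℂ) * u) • f) y).re| ≤ ‖y‖ := fun y => (hφ y) ▸ hf y
  -- the slice passes from `A′` to `A₁ = A′ − H_V(Q_VA′)`
  have hsliceA₁ : RE D c (dsE c (WithLp.toLp 2 (fun b => (((((r : ℝ) : ℂ) * u) • f) ((A' - HV (QV A')) b)).re))) = 0 := by
    rw [RE_dsE_re_reading_sub_HV D hc hw hHV _ A' (QV A')]
    exact hslice _
  have key := dcsE_dcE_re_reading_of_solution D hc hw hGV hMV hsol ((((r : ℝ) : ℂ) * u) • f) hsliceA₁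
  have hfun : (fun b' => r * (u * f ((A' - HV (QV A')) b')).re) = fun b' => (((((r : ℝ) : ℂ) * u) • f) ((A' - HV (QV A')) b')).re :=
    funext fun b' => hφ _
  rw [hfun, key, PiLp.add_apply, PiLp.neg_apply, PiLp.toLp_apply, PiLp.toLp_apply]
  -- the (98)-slot: weighted on the torus, plain at `b` (`wt₃ b = 1`)
  have hW : ∀ b', wt 3 b' * ‖W A' b'‖ ≤ C₄ * ρ ^ 2 := hWq A' ρ hρ h1 h2
  have hC : 0 ≤ C₄ * ρ ^ 2 := (mul_nonneg (hw0 3 b) (norm_nonneg _)).trans (hW b)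
  have hwb : |(((((r : ℝ) : ℂ) * u) • f) (W A' b)).re| ≤ C₄ * ρ ^ 2 := by
    refine (hφle _).trans ?_
    have h := hW b
    rwa [hS b hb, one_mul] at h
  -- the multiplier letter on the read current `Re φ ∘ W A′`
  have hg : ∀ b', wt 3 b' * |(((((r : ℝ) : ℂ) * u) • f) (W A' b')).re| ≤ C₄ * ρ ^ 2 := fun b' =>
    (mul_le_mul_of_nonneg_left (hφle _) (hw0 3 b')).trans (hW b')
  have hMb := hM (fun b' => (((((r : ℝ) : ℂ) * u) • f) (W A' b')).re) (C₄ * ρ ^ 2) hC hg b hb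
  have hMread : (((((r : ℝ) : ℂ) * u) • f) (MV (W A') b)).re =
      (QsE D (EE D hc hw (QE D (GE D hc hw (WithLp.toLp 2 fun b' => (((((r : ℝ) : ℂ) * u) • f) (W A' b')).re))))) b := by
    have h := congrArg (fun v : BondSpace P => v b) (toLp_re_reading_extension _ (fun b' => hMV (W A') b') ((((r : ℝ) : ℂ) * u) • f))
    simpa only [PiLp.toLp_apply, LinearMap.comp_apply] using h
  calc |-(((((r : ℝ) : ℂ) * u) • f) (W A' b)).re + (((((r : ℝ) : ℂ) * u) • f) (MV (W A') b)).re|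
      ≤ |-(((((r : ℝ) : ℂ) * u) • f) (W A' b)).re| + |(((((r : ℝ) : ℂ) * u) • f) (MV (W A') b)).re| := abs_add_le _ _
    _ ≤ C₄ * ρ ^ 2 + BM * (C₄ * ρ ^ 2) := by
        rw [abs_neg, hMread]
        exact add_le_add hwb hMb
    _ = (1 + BM) * (C₄ * ρ ^ 2) := by ring
end Row

/-! ## §4  At NODE 00's fine torus: p604735's hypothesis block (`𝔰𝔲(N)`-valued (128), `c = Lᵏ`, `a ≡ 1`), instances unifiable -/

section Record

/-- ★★★ **THE `∂^{ξ*}∂^ξ` ROW OF (165) FOR THE TANGENT COMPONENT AT THE RECORD, MODULO THE MULTIPLIER LETTER** — §3 on NODE 00's fine torus `Site (F.P K) 0` in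
p604735's hypothesis block (`c = Lᵏ`, `a ≡ 1`, `M_N(ℂ)`, both `DecidableEq` instances unifiable; `𝔰𝔲(N)`-valued `X` and tests, reduced to the skew test class by p596821 §0):
(128) (S2) + Prop. 4's weighted (98)-slot `hWq` (S4b) + sizes `≤ ρ < a₃` (S3) + THE SLICE (153) for every reading `Re φ ∘ X` (n07-w3's `RE_dsE_re_eq_zero_of_cubeDomains`
shape; by §2 the same for `X = A′` and for the potential `A = A′ − H_V𝔇(A′)`) + weights `wt₃ = 1` on a bond set `S` (the head's top window,
`N07Letters10OfRealRows.levWeightP_eq_one_of_inOm_top`) + the DISPLAYED MULTIPLIER LETTER `hM` on `S` ⇒ for every duality reading of norm `≤ 1` and every `b ∈ S`: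
`|dcsE Lᵏ (dcE Lᵏ (b′ ↦ r·Re(u·f(A₁ b′)))) b| ≤ (1 + B_𝔐)·(C₄·ρ²)`, `A₁ = X − H_V(Q_VX)` — the third conjunct of `letters10On_of_realRows`' `hrows` (`ξ⁻¹ = Lᵏ`).
[cite: Balaban1985Variational, (128) p.297, (131)–(133) p.298, (152)–(153) p.301, (158) p.302, (165) p.304; Balaban1984PropagatorsII, (2.19) p.226, (2.35) p.228] -/
theorem curlCurl_row_of_critical128 (F : T4Family) (K k : ℕ) (wt : ℕ → PBond (F.P K) 0 → ℝ) (hw0 : ∀ m b, 0 ≤ wt m b)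
    (D : Domains (F.P K))
    {instDE : DecidableEq (PBond (F.P K) 0)} {instDB : DecidableEq (BondIdx D)}
    {DV GV MV : (PBond (F.P K) 0 → Matrix (Fin N) (Fin N) ℂ) →ₗ[ℂ] (PBond (F.P K) 0 → Matrix (Fin N) (Fin N) ℂ)}
    {QV : (PBond (F.P K) 0 → Matrix (Fin N) (Fin N) ℂ) →ₗ[ℂ] (BondIdx D → Matrix (Fin N) (Fin N) ℂ)}
    {HV : (BondIdx D → Matrix (Fin N) (Fin N) ℂ) →ₗ[ℂ] (PBond (F.P K) 0 → Matrix (Fin N) (Fin N) ℂ)}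
    (hDV : ∀ (A : PBond (F.P K) 0 → Matrix (Fin N) (Fin N) ℂ) (b : PBond (F.P K) 0),
      DV A b = ∑ j, ((WithLp.ofLp (deltaAE D ((F.P K).L ^ k : ℝ) (fun _ => (1 : ℝ)) (WithLp.toLp 2 (Pi.single j 1))) b : ℝ) : ℂ) • A j)
    (hGV : ∀ (A : PBond (F.P K) 0 → Matrix (Fin N) (Fin N) ℂ) (b : PBond (F.P K) 0),
      GV A b = ∑ j, ((WithLp.ofLp ((GE D (c := ((F.P K).L : ℝ) ^ k) (pow_ne_zero _ (Nat.cast_ne_zero.2 (F.P K).L_pos.ne')) (w := fun _ => (1 : ℝ)) (fun _ => one_pos)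
        - hOp (GE D (c := ((F.P K).L : ℝ) ^ k) (pow_ne_zero _ (Nat.cast_ne_zero.2 (F.P K).L_pos.ne')) (w := fun _ => (1 : ℝ)) (fun _ => one_pos)) (QsE D)
            (EE D (c := ((F.P K).L : ℝ) ^ k) (pow_ne_zero _ (Nat.cast_ne_zero.2 (F.P K).L_pos.ne')) (w := fun _ => (1 : ℝ)) (fun _ => one_pos))
          ∘ₗ QE D ∘ₗ GE D (c := ((F.P K).L : ℝ) ^ k) (pow_ne_zero _ (Nat.cast_ne_zero.2 (F.P K).L_pos.ne')) (w := fun _ => (1 : ℝ)) (fun _ => one_pos))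
        (WithLp.toLp 2 (Pi.single j 1))) b : ℝ) : ℂ) • A j)
    (hQV : ∀ (A : PBond (F.P K) 0 → Matrix (Fin N) (Fin N) ℂ) (t : BondIdx D),
      QV A t = ∑ j, ((WithLp.ofLp (QE D (WithLp.toLp 2 (Pi.single j 1))) t : ℝ) : ℂ) • A j)
    (hHV : ∀ (B : BondIdx D → Matrix (Fin N) (Fin N) ℂ) (b : PBond (F.P K) 0),
      HV B b = ∑ t, ((WithLp.ofLp (hOp (GE D (c := ((F.P K).L : ℝ) ^ k) (pow_ne_zero _ (Nat.cast_ne_zero.2 (F.P K).L_pos.ne')) (w := fun _ => (1 : ℝ)) (fun _ => one_pos))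
        (QsE D) (EE D (c := ((F.P K).L : ℝ) ^ k) (pow_ne_zero _ (Nat.cast_ne_zero.2 (F.P K).L_pos.ne')) (w := fun _ => (1 : ℝ)) (fun _ => one_pos))
        (WithLp.toLp 2 (Pi.single t 1))) b : ℝ) : ℂ) • B t)
    (hMV : ∀ (A : PBond (F.P K) 0 → Matrix (Fin N) (Fin N) ℂ) (b : PBond (F.P K) 0),
      MV A b = ∑ j, ((WithLp.ofLp ((QsE D
          ∘ₗ EE D (c := ((F.P K).L : ℝ) ^ k) (pow_ne_zero _ (Nat.cast_ne_zero.2 (F.P K).L_pos.ne')) (w := fun _ => (1 : ℝ)) (fun _ => one_pos)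
          ∘ₗ QE D ∘ₗ GE D (c := ((F.P K).L : ℝ) ^ k) (pow_ne_zero _ (Nat.cast_ne_zero.2 (F.P K).L_pos.ne')) (w := fun _ => (1 : ℝ)) (fun _ => one_pos))
        (WithLp.toLp 2 (Pi.single j 1))) b : ℝ) : ℂ) • A j)
    (W : (PBond (F.P K) 0 → Matrix (Fin N) (Fin N) ℂ) → (PBond (F.P K) 0 → Matrix (Fin N) (Fin N) ℂ)) {C₄ a₃ ρ : ℝ}
    (hWq : ∀ (Y : PBond (F.P K) 0 → Matrix (Fin N) (Fin N) ℂ) (r : ℝ), r < a₃ → (∀ b, wt 1 b * ‖Y b‖ ≤ r) →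
      (∀ (b : PBond (F.P K) 0) (ν : Fin 4), wt 2 b * (F.L : ℝ) ^ k * ‖Y ⟨b.src.shift ν, b.dir⟩ - Y b‖ ≤ r) →
        ∀ b, wt 3 b * ‖W Y b‖ ≤ C₄ * r ^ 2)
    (X : PBond (F.P K) 0 → lieSU (Fin N))
    (hWA : ∀ j, (W (fun b => ((X b : lieSU (Fin N)) : Matrix (Fin N) (Fin N) ℂ)) j)ᴴ = -(W (fun b => ((X b : lieSU (Fin N)) : Matrix (Fin N) (Fin N) ℂ)) j))
    (hWtr : ∀ j, (W (fun b => ((X b : lieSU (Fin N)) : Matrix (Fin N) (Fin N) ℂ)) j).trace = 0)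
    (h128 : ∀ δ : PBond (F.P K) 0 → lieSU (Fin N), QV (fun j => ((δ j : lieSU (Fin N)) : Matrix (Fin N) (Fin N) ℂ)) = 0 →
      ∑ j, (((δ j : lieSU (Fin N)) : Matrix (Fin N) (Fin N) ℂ)ᴴ *
        (DV (fun b => ((X b : lieSU (Fin N)) : Matrix (Fin N) (Fin N) ℂ)) j + W (fun b => ((X b : lieSU (Fin N)) : Matrix (Fin N) (Fin N) ℂ)) j)).trace.re = 0)
    (hρ : ρ < a₃) (h1 : ∀ b, wt 1 b * ‖((X b : lieSU (Fin N)) : Matrix (Fin N) (Fin N) ℂ)‖ ≤ ρ)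
    (h2 : ∀ (b : PBond (F.P K) 0) (ν : Fin 4),
      wt 2 b * (F.L : ℝ) ^ k * ‖((X ⟨b.src.shift ν, b.dir⟩ : lieSU (Fin N)) : Matrix (Fin N) (Fin N) ℂ) - ((X b : lieSU (Fin N)) : Matrix (Fin N) (Fin N) ℂ)‖ ≤ ρ)
    (hslice : ∀ φ : Matrix (Fin N) (Fin N) ℂ →L[ℂ] ℂ,
      RE D (((F.P K).L : ℝ) ^ k) (dsE (((F.P K).L : ℝ) ^ k) (WithLp.toLp 2 (fun b => (φ ((X b : lieSU (Fin N)) : Matrix (Fin N) (Fin N) ℂ)).re))) = 0)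
    {S : Set (PBond (F.P K) 0)} (hS : ∀ b ∈ S, wt 3 b = 1) {BM : ℝ}
    (hM : ∀ (g : PBond (F.P K) 0 → ℝ) (β : ℝ), 0 ≤ β → (∀ b, wt 3 b * |g b| ≤ β) → ∀ b ∈ S,
      |(QsE D (EE D (c := ((F.P K).L : ℝ) ^ k) (pow_ne_zero _ (Nat.cast_ne_zero.2 (F.P K).L_pos.ne')) (w := fun _ => (1 : ℝ)) (fun _ => one_pos)
        (QE D (GE D (c := ((F.P K).L : ℝ) ^ k) (pow_ne_zero _ (Nat.cast_ne_zero.2 (F.P K).L_pos.ne')) (w := fun _ => (1 : ℝ)) (fun _ => one_pos)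
          (WithLp.toLp 2 g))))) b| ≤ BM * β) :
    ∀ (f : Matrix (Fin N) (Fin N) ℂ →L[ℂ] ℂ) (u : ℂ) (r : ℝ), (∀ y : Matrix (Fin N) (Fin N) ℂ, |r * (u * f y).re| ≤ ‖y‖) →
      ∀ b ∈ S,
        |dcsE (((F.P K).L : ℝ) ^ k) (dcE (((F.P K).L : ℝ) ^ k)
            (WithLp.toLp 2 fun b' => r * (u * f (((fun b => ((X b : lieSU (Fin N)) : Matrix (Fin N) (Fin N) ℂ)) -
              HV (QV fun b => ((X b : lieSU (Fin N)) : Matrix (Fin N) (Fin N) ℂ))) b')).re)) b|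
          ≤ (1 + BM) * (C₄ * ρ ^ 2) := by
  have hc : (((F.P K).L : ℝ)) ^ k ≠ 0 := pow_ne_zero _ (Nat.cast_ne_zero.2 (F.P K).L_pos.ne')
  -- (128) against the skew test class (p596821 §0): the 𝔰𝔲(N) tests suffice
  have h128' : ∀ δ : PBond (F.P K) 0 → Matrix (Fin N) (Fin N) ℂ, (∀ j, (δ j)ᴴ = -δ j) →
      QV δ = 0 → ∑ j, ((δ j)ᴴ * (DV (fun b => ((X b : lieSU (Fin N)) : Matrix (Fin N) (Fin N) ℂ)) j +
        W (fun b => ((X b : lieSU (Fin N)) : Matrix (Fin N) (Fin N) ℂ)) j)).trace.re = 0 := by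
    refine pairing_skew_of_traceless
      ((WithLp.linearEquiv 2 ℝ (PBond (F.P K) 0 → ℝ)).toLinearMap ∘ₗ deltaAE D (((F.P K).L : ℝ) ^ k) (fun _ => (1 : ℝ)) ∘ₗ
        (WithLp.linearEquiv 2 ℝ (PBond (F.P K) 0 → ℝ)).symm.toLinearMap)
      ((WithLp.linearEquiv 2 ℝ (BondIdx D → ℝ)).toLinearMap ∘ₗ QE D ∘ₗ (WithLp.linearEquiv 2 ℝ (PBond (F.P K) 0 → ℝ)).symm.toLinearMap)
      (fun A b => ?_) (fun A t => ?_) (fun j => coe_lieSU_trace (X j)) hWtr (pairing_traceless_of_lieSU h128)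
    · simp only [LinearMap.comp_apply, LinearEquiv.coe_coe, WithLp.coe_linearEquiv, WithLp.coe_symm_linearEquiv]; exact hDV A b
    · simp only [LinearMap.comp_apply, LinearEquiv.coe_coe, WithLp.coe_linearEquiv, WithLp.coe_symm_linearEquiv]; exact hQV A t
  exact curlCurl_row_of_critical128_model D hc (fun _ => one_pos) wt hw0 hDV hGV hQV hHV hMV W hWq (fun j => coe_lieSU_skew (X j)) hWA h128' hρ h1 h2
    hslice hS hM
end Record

end Summit.QuantumFields.YangMills.Theorems.K0Stub1CurlCurlRowOfEq158

end
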